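import Summits.QuantumFields.YangMills.Theses.FluxSectorLaplace
import Summits.QuantumFields.YangMills.Theorems.QuantileBitPurityFluxSuppression
import HarnessLib

/-!
# `FluxSectorLaplace.FluxSectorSuppression` (item stmt-QuantumFields-24079) — PROVED by flux reflection

Route `FluxSectorLaplace` (D-0145 LINE g13-B of ideator seat ym-idea-4), crux K1 ⟨24079⟩ ELECTRIC-FLUX SECTOR SUPPRESSION on the Laplace window:
with `a = 1/1600`, for `β ≥ β₀` and every `1 ≤ L ≤ β^a`, every twisted seam sector `z ≠ 0` of the `2L`-slice zero-flux ring has total weight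
`TT.sectorWeight β (2L−1) z 1 ≤ β^(−a) · Z_phys(L, β, 2L)`.

METHOD (seat ym-dw-p1 g17, modules `Theorems/QuantileBitPurityFlux*`): FLUX REFLECTION — no semiclassics, no Laplace asymptotics.  The `x`-twisted
sector weight is a pairing `∫dx ⟨Ψ(x,·), Ψ(tw x,·)⟩` of two gauge-averaged half rings (`FluxRepresentation`); the sign bit `O = sign Re tr P_x` is odd under
the twist, so along the ring the bit must vanish or flip, and Cauchy–Schwarz (`FluxReflection*`) bounds the twisted total by
`3√W_0(1)·√W_0(thin equator band) + bad fields` in the UNTWISTED sector (`FluxBound`, `FluxGood`); the thin band `{|Re tr P_x| ≤ 8L²β^(−19/40)}` is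
`O(β^(−1/400))` of `Z_phys` by the tree's own-axis translate estimate at the equator (`FluxSuppression`, `FluxNumerics`); the other twisted sectors follow
by axis permutation.  Rate: `13 β^(−1/800) ≤ β^(−1/1600)` for `β ≥ 13^1600`.

HONEST FRAMING: one crux (K1) of a DRAFT-by-design line; K2 `PeriodicCoreRaritySubQuartic` ⟨24080⟩ is untouched; a fixed-lattice estimate uniform on the
window `L ≤ β^(1/1600)`; nothing about infinite volume, the continuum limit or the Clay Yang–Mills gap — the YM mass gap is NOT proved.  No `sorry`, no
new axiom, no new definition.  References: [cite: tHooft1979]; [cite: Luscher1983, §2]; E. T. Tomboulis, L. G. Yaffe, CMP 100 (1985) 313.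
-/

set_option autoImplicit false

noncomputable section

open MeasureTheory Real
open Literature.MathematicalPhysics.QuantumLattice
open Literature.MathematicalPhysics.QuantumFieldTheory hiding SU2
open Summit.QuantumFields.YangMills.Theorems
open Summit.QuantumFields.YangMills.Theorems.FemtoTransferGap
open Summit.QuantumFields.YangMills.Theorems.FemtoTransferGap.TT
open Summit.QuantumFields.YangMills.Theorems.FemtoTransferGap.OwnAxis

namespace Summit.QuantumFields.YangMills.Theorems.FluxSectorLaplace

/-- ★ **Crux K1 of route `FluxSectorLaplace`, proved**: electric-flux sector suppression on the window `L ≤ β^(1/1600)` with rate `β^(−1/1600)`.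
[cite: tHooft1979] [cite: Luscher1983, §2] -/
theorem fluxSectorSuppression_proof : Summit.QuantumFields.YangMills.Theses.FluxSectorLaplace.FluxSectorSuppression := by
  obtain ⟨β₀, h⟩ := Summit.QuantumFields.YangMills.Theorems.FemtoTransferGap.Flux.sectorWeight_ne_zero_le_rpow_even (a := 1 / 400) (by norm_num) le_rfl
  refine ⟨1 / 1600, by norm_num, max β₀ (max 200 ((13 : ℝ) ^ (1 / (-(-(1 / 1600 : ℝ)))))), 1, fun β hβ L _ hL1 hLa z hz => ?_⟩
  simp only [max_le_iff] at hβ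
  obtain ⟨hβ₀, h200, h13⟩ := hβ
  have hβ1 : (1 : ℝ) ≤ β := le_trans (by norm_num) h200
  have hβ0 : (0 : ℝ) < β := lt_of_lt_of_le (by norm_num) h200
  -- the window `L ≤ β^{1/1600} ≤ β^{1/400}`
  have hLa' : (L : ℝ) ≤ β ^ (1 / 400 : ℝ) := hLa.trans (Real.rpow_le_rpow_of_exponent_le hβ1 (by norm_num))
  -- the ring of `2L` slices: `2L − 1 = 1 + (q + q)` with `q = L − 1`
  obtain ⟨q, hq⟩ : ∃ q : ℕ, 2 * L - 1 = 1 + (q + q) := ⟨L - 1, by omega⟩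
  have hn2 : 1 + (q + q) + 1 ≤ 2 * L := by omega
  have hmain := h β hβ₀ L hLa' q hn2 z hz
  rw [physTrace, hq]
  -- `13 β^{−1/800} ≤ β^{−1/1600}`
  have hZ : 0 ≤ physTraceSucc L β (1 + (q + q)) := physTraceSucc_nonneg_of (L := L) (by omega) h200
  have hrate : 13 * β ^ (-((1 / 400 : ℝ) / 2)) ≤ β ^ (-(1 / 1600 : ℝ)) := by
    have key : 13 * β ^ (-(1 / 1600 : ℝ)) ≤ 1 := mul_rpow_le_one_of_le (by norm_num) (by norm_num) h13
    have hsplit : β ^ (-((1 / 400 : ℝ) / 2)) = β ^ (-(1 / 1600 : ℝ)) * β ^ (-(1 / 1600 : ℝ)) := by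
      rw [← Real.rpow_add hβ0]; norm_num
    rw [hsplit, ← mul_assoc]
    have h0 : 0 ≤ β ^ (-(1 / 1600 : ℝ)) := Real.rpow_nonneg hβ0.le _
    nlinarith
  calc sectorWeight (L := L) β (1 + (q + q)) z (fun _ _ => (1 : ℝ)) ≤ 13 * β ^ (-((1 / 400 : ℝ) / 2)) * physTraceSucc L β (1 + (q + q)) := hmain
    _ ≤ β ^ (-(1 / 1600 : ℝ)) * physTraceSucc L β (1 + (q + q)) := mul_le_mul_of_nonneg_right hrate hZ

end Summit.QuantumFields.YangMills.Theorems.FluxSectorLaplace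

end
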